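import Summits.BirchSwinnertonDyer.BirchSwinnertonDyer.Theorems.PrintCf2SplitBadTwoRestrictedControlOfResiduals
import HarnessLib

/-!
# Crux `PrintCf2.SplitBadTwoRankOneOfFacts` (stmt-BirchSwinnertonDyer-20368), road α v10.3 — S3c assembly, SECOND CUT:
# the level-`K` residual (R-LEVELK) SPLIT into (R-SURJ) «control cokernel = ∏ local kernels» and (R-BV) «bottom value law»

Cell `bsd-print-cf2`, LEAD seat `bsd-line-cf2-p1` g12 (prover-bsd-line-cf2-p1-g12-0); `--supports stmt-BirchSwinnertonDyer-20368` (helper, Theses-free).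
HONEST FRAMING: proves the registered statement of S3c from DISPLAYED HYPOTHESES; nothing here is a named fact; BSD is not proved by any of this; no
summit statement is proved by this seat. No definition, no `sorry`.

WHY A SECOND CUT. The first assembly (`restrictedControl_two_of_residuals`, p664178) kept the bottom value and the exact cokernel in ONE law
(R-LEVELK) because the apportioning of member-dependent units between them was not settled. Two rulings of this seat settle it
(`Cruxes/…/S3C-DEFECT-VANISHES-g12.md`, and the «no exceptional members» ruling on -w7 g2's BOTTOM-VALUE-SNAKE §3(a)): in analytic rank one the
SURJECTIVITY DEFECT of the lift map `res⁻¹(𝔖^Γ) → ⊕_{w ∈ T ∪ {v̄}} LK_w` VANISHES (its Poitou–Tate dual is `H¹_{str v}(K_Σ/K, T_v E) = 0`: rank-one Euler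
characteristic over `K` + `loc_v` injective), so the cokernel is EXACTLY `∏_{w ∈ T} #LK_w · #LK_{v̄}` member by member — a statement with NO class
function — and the bottom value ALONE carries the class function `e_K`. Hence (R-LEVELK) ⟸ (R-SURJ) ∧ (R-BV), both sharper, both true-as-stated
targets for the width lanes (-w7 g2: three-factor snake = R-BV; the Poitou–Tate lane: R-SURJ).

* `padicValNat_finset_prod` (private) — `v_p(∏ f) = Σ v_p(f)` for non-zero factors.
* **`restrictedControl_two_of_residuals_split`** — S3c VERBATIM ⟸ (R-CFT: C1, H7) ∧ (R-TOP) ∧ (R-DYADIC) ∧ (R-SEVEN) ∧ (R-SURJ) ∧ (R-BV), by deriving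
  p664178's (R-LEVELK) from (R-SURJ) ∧ (R-BV) (the local kernels are finite and non-empty on every frame: -w3 g7
  `finite_and_natCard_localKer_top_of_frame_le_two`, `finite_and_natCard_localKer_top_vbar_of_frame_le_four`) and invoking p664178.
presearch: not applicable (assembly; no stub, no fact filed). beyond-print theorem: no.

References: [Agboola2007] §3 Prop. 3.2, §6 Prop. 6.10–6.11, Prop. 8.1; [GreenbergLNM1716] §3 Lemmas 3.1–3.3; [MilneADT2006] I Thm. 4.10, I.6.
-/

noncomputable section

open scoped Classical

set_option linter.dupNamespace false
set_option autoImplicit false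

open NumberField IsDedekindDomain Field WeierstrassCurve
open Literature.NumberTheory.EllipticCurves Literature.NumberTheory.EllipticCurves.GreenbergSelmer
open Literature.NumberTheory.EllipticCurves.Agboola2007
open Literature.NumberTheory.EllipticCurves.IwasawaAlgebra
open Literature.NumberTheory.EllipticCurves.IwasawaDual
open Literature.NumberTheory.EllipticCurves.ResKernel
open Literature.NumberTheory.GaloisRepresentations

namespace Summit.BirchSwinnertonDyer.BirchSwinnertonDyer.Theorems.PrintCf2.RestrictedSelmerPair

/-- `v_p (∏_{i ∈ s} f i) = Σ_{i ∈ s} v_p (f i)` when no factor vanishes (`padicValNat.mul`, Finset induction). [folklore] -/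
private theorem padicValNat_finset_prod {ι : Type*} (p : ℕ) [Fact p.Prime] (s : Finset ι) (f : ι → ℕ)
    (hf : ∀ i ∈ s, f i ≠ 0) : padicValNat p (∏ i ∈ s, f i) = ∑ i ∈ s, padicValNat p (f i) := by
  induction s using Finset.induction_on with
  | empty => simp
  | insert a s ha ih =>
    rw [Finset.prod_insert ha, Finset.sum_insert ha,
      padicValNat.mul (hf a (Finset.mem_insert_self a s))
        (Finset.prod_ne_zero_iff.mpr fun i hi ↦ hf i (Finset.mem_insert_of_mem hi)),
      ih fun i hi ↦ hf i (Finset.mem_insert_of_mem hi)]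

/-- **S3c `stub_restrictedControl_two` FROM (R-CFT: C1, H7) (R-TOP) (R-DYADIC) (R-SEVEN) (R-SURJ) (R-BV)** — the second cut of the LEAD's assembly:
p664178's level-`K` law (R-LEVELK) is derived from the EXACT cokernel (R-SURJ, no class function) and the bottom value law (R-BV), then
`restrictedControl_two_of_residuals` is invoked. [cite: Agboola2007, §3 Prop. 3.2, §6 Prop. 6.10–6.11, Prop. 8.1] [cite: GreenbergLNM1716, §3 Lemmas 3.1–3.3] -/
theorem restrictedControl_two_of_residuals_split
    (hC1 : ∀ (K : Type) [Field K] [NumberField K], IsImaginaryQuadratic K →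
      ∀ (vbar : HeightOneSpectrum (𝓞 K)), ((2 : ℕ) : 𝓞 K) ∈ vbar.asIdeal →
      ∀ (κ' : ZpExtension K 2), κ'.IsUnramifiedOutside vbar →
      ∀ (w : HeightOneSpectrum (𝓞 K)), ((2 : ℕ) : 𝓞 K) ∉ w.asIdeal → ¬ decomp w ≤ κ'.kerSubgroup)
    (hH7 : ∀ (K : Type) [Field K] [NumberField K], IsImaginaryQuadratic K →
      ∀ (vbar : HeightOneSpectrum (𝓞 K)), ((2 : ℕ) : 𝓞 K) ∈ vbar.asIdeal →
      ∀ (κ' : ZpExtension K 2), κ'.IsUnramifiedOutside vbar →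
      ∀ (w : HeightOneSpectrum (𝓞 K)), ((7 : ℕ) : 𝓞 K) ∈ w.asIdeal → ¬ decomp w ≤ κ'.layerSubgroup 1)
    (hTop : ∀ (d : ℤ), d ≠ 0 → ∀ (W : WeierstrassCurve ℚ) [W.IsElliptic] (C : VariableChange ℚ),
      C • W = cm7.quadraticTwist (d : ℚ) →
      ∀ (K : Type) [Field K] [NumberField K], IsImaginaryQuadratic K →
      ∀ (v vbar : HeightOneSpectrum (𝓞 K)),
        ((2 : ℕ) : 𝓞 K) ∈ v.asIdeal → ((2 : ℕ) : 𝓞 K) ∈ vbar.asIdeal → vbar ≠ v →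
      ∀ (π : (W.baseChange K).endRing), (π : AddMonoid.End (W.baseChange K).geomPoints) * π = π - 2 →
      ∀ (r : ℤ_[2]), r * r = r - 2 →
        (∀ τ ∈ GreenbergSelmer.inertia v, ∀ x : ↥((W.baseChange K).endEigenPrimaryTorsion 2 π r), τ • x = x ∨ τ • x = -x) →
      ∀ (κ' : ZpExtension K 2), κ'.IsUnramifiedOutside vbar → ∀ (γ' : absoluteGaloisGroup K), κ'.IsTopGenerator γ' →
      ∀ (D : Agboola2007.RestrictedDualData κ' ↥((W.baseChange K).endEigenPrimaryTorsion 2 π r) vbar γ') (n : ℕ),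
        Module.Finite (IwasawaAlgebra 2) D.X → D.HasCharValuationAt n →
        Nat.card (EndCoinvariants
          (conjRestricted κ' ↥((W.baseChange K).endEigenPrimaryTorsion 2 π r) vbar γ' - 1)) = 1)
    (hDy : ∃ ev : ℤ → ℤ → ℤ, ∀ (d : ℤ), d ≠ 0 → Squarefree d → d % 4 ≠ 1 →
      ∀ (W : WeierstrassCurve ℚ) [W.IsElliptic] (C : VariableChange ℚ), C • W = cm7.quadraticTwist (d : ℚ) →
      ∀ (K : Type) [Field K] [NumberField K], IsImaginaryQuadratic K →
      ∀ (v vbar : HeightOneSpectrum (𝓞 K)),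
        ((2 : ℕ) : 𝓞 K) ∈ v.asIdeal → ((2 : ℕ) : 𝓞 K) ∈ vbar.asIdeal → vbar ≠ v →
      ∀ (π : (W.baseChange K).endRing), (π : AddMonoid.End (W.baseChange K).geomPoints) * π = π - 2 →
      ∀ (r : ℤ_[2]), r * r = r - 2 →
        (∀ τ ∈ GreenbergSelmer.inertia v, ∀ x : ↥((W.baseChange K).endEigenPrimaryTorsion 2 π r), τ • x = x ∨ τ • x = -x) →
      ∀ (κ' : ZpExtension K 2), κ'.IsUnramifiedOutside vbar →
        (padicValNat 2 (Nat.card (resOfLe ↥((W.baseChange K).endEigenPrimaryTorsion 2 π r)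
          (inf_le_inf_right (decomp vbar) (le_top : κ'.kerSubgroup ≤ ⊤))).ker) : ℤ) = ev (d % 2) ((d / (2 - d % 2)) % 8))
    (hSeven : ∀ (d : ℤ), Squarefree d → d % 4 ≠ 1 → (7 : ℤ) ∣ d →
      ∀ (W : WeierstrassCurve ℚ) [W.IsElliptic] (C : VariableChange ℚ), C • W = cm7.quadraticTwist (d : ℚ) →
      W.torsionOrder = 2 ∧
      ∀ (K : Type) [Field K] [NumberField K], IsImaginaryQuadratic K →
      ∀ (vbar : HeightOneSpectrum (𝓞 K)), ((2 : ℕ) : 𝓞 K) ∈ vbar.asIdeal →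
      ∀ (π : (W.baseChange K).endRing), (π : AddMonoid.End (W.baseChange K).geomPoints) * π = π - 2 →
      ∀ (r : ℤ_[2]), r * r = r - 2 → ∀ (κ' : ZpExtension K 2), κ'.IsUnramifiedOutside vbar →
      ∀ (T : Finset (HeightOneSpectrum (𝓞 K))),
        (∀ w : HeightOneSpectrum (𝓞 K), w ∈ T ↔ ((2 : ℕ) : 𝓞 K) ∉ w.asIdeal ∧ ((7 * d : ℤ) : 𝓞 K) ∈ w.asIdeal) →
        (∀ w ∈ T, ¬ decomp w ≤ κ'.kerSubgroup) →
        (∑ w ∈ T, padicValNat 2 (Nat.card (resOfLe ↥((W.baseChange K).endEigenPrimaryTorsion 2 π r)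
          (inf_le_inf_right (decomp w) (le_top : κ'.kerSubgroup ≤ ⊤))).ker)) + 2 = padicValNat 2 W.tamagawaProduct)
    -- (R-SURJ) the lift map `res⁻¹(𝔖^Γ) → ⊕_{w ∈ T ∪ {v̄}} LK_w` is ONTO: the control cokernel IS the product of the local kernels
    (hSurj : ∀ (d : ℤ), d ≠ 0 → Squarefree d → d % 4 ≠ 1 →
      ∀ (W : WeierstrassCurve ℚ) [W.IsElliptic] [W.IsGloballyMinimal] (C : VariableChange ℚ),
        C • W = cm7.quadraticTwist (d : ℚ) → W.analyticRank = 1 →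
      ∀ (K : Type) [Field K] [NumberField K], IsImaginaryQuadratic K →
      ∀ (v vbar : HeightOneSpectrum (𝓞 K)),
        ((2 : ℕ) : 𝓞 K) ∈ v.asIdeal → ((2 : ℕ) : 𝓞 K) ∈ vbar.asIdeal → vbar ≠ v →
      ∀ (π : (W.baseChange K).endRing), (π : AddMonoid.End (W.baseChange K).geomPoints) * π = π - 2 →
      ∀ (r : ℤ_[2]), r * r = r - 2 →
        (∀ τ ∈ GreenbergSelmer.inertia v, ∀ x : ↥((W.baseChange K).endEigenPrimaryTorsion 2 π r), τ • x = x ∨ τ • x = -x) →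
      ∀ (κ' : ZpExtension K 2), κ'.IsUnramifiedOutside vbar → ∀ (γ' : absoluteGaloisGroup K), κ'.IsTopGenerator γ' →
      ∀ (T : Finset (HeightOneSpectrum (𝓞 K))),
        (∀ w : HeightOneSpectrum (𝓞 K), w ∈ T ↔ ((2 : ℕ) : 𝓞 K) ∉ w.asIdeal ∧ ((7 * d : ℤ) : 𝓞 K) ∈ w.asIdeal) →
        (((restrictedSelmerBase ↥((W.baseChange K).endEigenPrimaryTorsion 2 π r) 2 vbar).map
            (resOfLe ↥((W.baseChange K).endEigenPrimaryTorsion 2 π r) (le_top : κ'.kerSubgroup ≤ ⊤))).addSubgroupOf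
            (restrictedSelmerZp κ' ↥((W.baseChange K).endEigenPrimaryTorsion 2 π r) vbar)).relIndex
          (endInvariants (conjRestricted κ' ↥((W.baseChange K).endEigenPrimaryTorsion 2 π r) vbar γ' - 1)) =
        (∏ w ∈ T, Nat.card (resOfLe ↥((W.baseChange K).endEigenPrimaryTorsion 2 π r) (inf_le_inf_right (decomp w) (le_top : κ'.kerSubgroup ≤ ⊤))).ker) *
          Nat.card (resOfLe ↥((W.baseChange K).endEigenPrimaryTorsion 2 π r) (inf_le_inf_right (decomp vbar) (le_top : κ'.kerSubgroup ≤ ⊤))).ker)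
    -- (R-BV) the BOTTOM VALUE law: `v₂ #𝔖_{v̄}(K, W*) = v₂ #Ш(W/ℚ)[2^∞] + 2ℓ + e_K([d]₂)` (Agboola Prop. 6.10–6.11 + 8.1 at the additive prime)
    (hBV : ∃ eK : ℤ → ℤ → ℤ, ∀ (d : ℤ), d ≠ 0 → Squarefree d → d % 4 ≠ 1 →
      ∀ (W : WeierstrassCurve ℚ) [W.IsElliptic] [W.IsGloballyMinimal] (C : VariableChange ℚ),
        C • W = cm7.quadraticTwist (d : ℚ) → W.analyticRank = 1 →
      ∀ (K : Type) [Field K] [NumberField K], IsImaginaryQuadratic K →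
      ∀ (v vbar : HeightOneSpectrum (𝓞 K)),
        ((2 : ℕ) : 𝓞 K) ∈ v.asIdeal → ((2 : ℕ) : 𝓞 K) ∈ vbar.asIdeal → vbar ≠ v →
      ∀ (π : (W.baseChange K).endRing), (π : AddMonoid.End (W.baseChange K).geomPoints) * π = π - 2 →
      ∀ (r : ℤ_[2]), r * r = r - 2 →
        (∀ τ ∈ GreenbergSelmer.inertia v, ∀ x : ↥((W.baseChange K).endEigenPrimaryTorsion 2 π r), τ • x = x ∨ τ • x = -x) →
      ∀ (P : W.toAffine.Point) (c₀ : ℕ) (ℓ : ℤ),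
        ¬ IsOfFinAddOrder P →
        (∀ R : W.toAffine.Point, ∃ (k : ℤ) (T : W.toAffine.Point), IsOfFinAddOrder T ∧ R = k • P + T) →
        c₀ ≠ 0 → (W.baseChange ℚ_[2]).IsInReductionKernel (c₀ • W.toPadicPoint 2 P) →
        ‖(W.baseChange ℚ_[2]).padicLogPoint (c₀ • W.toPadicPoint 2 P) / (c₀ : ℚ_[2])‖ = (2 : ℝ) ^ (-ℓ) →
      Finite (restrictedSelmerBase ↥((W.baseChange K).endEigenPrimaryTorsion 2 π r) 2 vbar) →
        (padicValNat 2 (Nat.card (restrictedSelmerBase ↥((W.baseChange K).endEigenPrimaryTorsion 2 π r) 2 vbar)) : ℤ) =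
          (padicValNat 2 (Nat.card (AddCommGroup.primaryComponent W.sha 2)) : ℤ) + 2 * ℓ + eK (d % 2) ((d / (2 - d % 2)) % 8)) :
    -- CONCLUSION: S3c `stub_restrictedControl_two`, v9 = v10.3 VERBATIM
    ∃ eC : ℤ → ℤ → ℤ,
    ∀ (d : ℤ), d ≠ 0 → Squarefree d → d % 4 ≠ 1 →
    ∀ (W : WeierstrassCurve ℚ) [W.IsElliptic] [W.IsGloballyMinimal] (C : VariableChange ℚ),
      C • W = cm7.quadraticTwist (d : ℚ) → W.analyticRank = 1 →
    ∀ (K : Type) [Field K] [NumberField K], IsImaginaryQuadratic K →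
    ∀ (v vbar : HeightOneSpectrum (𝓞 K)),
      ((2 : ℕ) : 𝓞 K) ∈ v.asIdeal → ((2 : ℕ) : 𝓞 K) ∈ vbar.asIdeal → vbar ≠ v →
    ∀ (π : (W.baseChange K).endRing), (π : AddMonoid.End (W.baseChange K).geomPoints) * π = π - 2 →
    ∀ (r : ℤ_[2]), r * r = r - 2 →
      (∀ τ ∈ GreenbergSelmer.inertia v, ∀ x : ↥((W.baseChange K).endEigenPrimaryTorsion 2 π r), τ • x = x ∨ τ • x = -x) →
    ∀ (κ' : ZpExtension K 2), κ'.IsUnramifiedOutside vbar → ∀ (γ' : absoluteGaloisGroup K), κ'.IsTopGenerator γ' →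
    ∀ (D : Agboola2007.RestrictedDualData κ' ↥((W.baseChange K).endEigenPrimaryTorsion 2 π r) vbar γ') (n : ℕ),
      Module.Finite (IwasawaAlgebra 2) D.X → D.HasCharValuationAt n →
    ∀ (P : W.toAffine.Point) (c₀ : ℕ) (ℓ : ℤ),
      ¬ IsOfFinAddOrder P →
      (∀ R : W.toAffine.Point, ∃ (k : ℤ) (T : W.toAffine.Point), IsOfFinAddOrder T ∧ R = k • P + T) →
      c₀ ≠ 0 → (W.baseChange ℚ_[2]).IsInReductionKernel (c₀ • W.toPadicPoint 2 P) →
      ‖(W.baseChange ℚ_[2]).padicLogPoint (c₀ • W.toPadicPoint 2 P) / (c₀ : ℚ_[2])‖ = (2 : ℝ) ^ (-ℓ) →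
      (n : ℤ) = ((padicValNat 2 (Nat.card (AddCommGroup.primaryComponent W.sha 2)) : ℤ)
            + (padicValNat 2 W.tamagawaProduct : ℤ)
            - 2 * (padicValNat 2 W.torsionOrder : ℤ) + 2 * ℓ) + eC (d % 2) ((d / (2 - d % 2)) % 8) := by
  refine restrictedControl_two_of_residuals hC1 hH7 hTop hDy hSeven ?_
  obtain ⟨eK, heK⟩ := hBV
  refine ⟨eK, ?_⟩
  intro d hd0 hsq hd4 W _ _ C hC hrk K _ _ hK v vbar hv hvbar hne π hrel r hr hpin κ' hκ' γ' hγ' P c₀ ℓ hP hgen hc₀ hker hlog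
    hfinB hfinI T hT
  haveI : (W.baseChange K).IsElliptic := inferInstanceAs ((W.map (algebraMap ℚ K)).IsElliptic)
  have hsurj := hSurj d hd0 hsq hd4 W C hC hrk K hK v vbar hv hvbar hne π hrel r hr hpin κ' hκ' γ' hγ' T hT
  have hbv := heK d hd0 hsq hd4 W C hC hrk K hK v vbar hv hvbar hne π hrel r hr hpin P c₀ ℓ hP hgen hc₀ hker hlog hfinB
  -- the local kernels are finite and non-empty, so their cardinalities are non-zero
  have hT0 : ∀ w ∈ T, Nat.card (resOfLe ↥((W.baseChange K).endEigenPrimaryTorsion 2 π r)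
      (inf_le_inf_right (decomp w) (le_top : κ'.kerSubgroup ≤ ⊤))).ker ≠ 0 := by
    intro w hw
    obtain ⟨h2w, h7d⟩ := (hT w).mp hw
    haveI := (finite_and_natCard_localKer_top_of_frame_le_two hd0 hsq W C hC hK vbar hvbar π hrel hr κ' hκ' h2w h7d).1
    exact Nat.card_pos.ne'
  have hvbar0 : Nat.card (resOfLe ↥((W.baseChange K).endEigenPrimaryTorsion 2 π r)
      (inf_le_inf_right (decomp vbar) (le_top : κ'.kerSubgroup ≤ ⊤))).ker ≠ 0 := by
    haveI := (finite_and_natCard_localKer_top_vbar_of_frame_le_four hd0 W C hC hK hv hvbar hne π hrel hr κ').1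
    exact Nat.card_pos.ne'
  have hrelv : padicValNat 2 ((((restrictedSelmerBase ↥((W.baseChange K).endEigenPrimaryTorsion 2 π r) 2 vbar).map
      (resOfLe ↥((W.baseChange K).endEigenPrimaryTorsion 2 π r) (le_top : κ'.kerSubgroup ≤ ⊤))).addSubgroupOf
      (restrictedSelmerZp κ' ↥((W.baseChange K).endEigenPrimaryTorsion 2 π r) vbar)).relIndex
      (endInvariants (conjRestricted κ' ↥((W.baseChange K).endEigenPrimaryTorsion 2 π r) vbar γ' - 1))) =
      (∑ w ∈ T, padicValNat 2 (Nat.card (resOfLe ↥((W.baseChange K).endEigenPrimaryTorsion 2 π r)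
        (inf_le_inf_right (decomp w) (le_top : κ'.kerSubgroup ≤ ⊤))).ker)) +
      padicValNat 2 (Nat.card (resOfLe ↥((W.baseChange K).endEigenPrimaryTorsion 2 π r)
        (inf_le_inf_right (decomp vbar) (le_top : κ'.kerSubgroup ≤ ⊤))).ker) := by
    rw [hsurj, padicValNat.mul (Finset.prod_ne_zero_iff.mpr hT0) hvbar0, padicValNat_finset_prod 2 T _ hT0]
  have hrelvZ := congrArg (fun n : ℕ ↦ (n : ℤ)) hrelv
  push_cast at hrelvZ hbv ⊢
  linarith

end Summit.BirchSwinnertonDyer.BirchSwinnertonDyer.Theorems.PrintCf2.RestrictedSelmerPair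

end
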